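import Literature.NumberTheory.GaloisRepresentations.KatzDetCongruenceLattice
import Literature.NumberTheory.EllipticCurves.KatzLatticeRationalTorsionProofs
import Literature.NumberTheory.EllipticCurves.GlobalMinimalModelProofs
import Literature.NumberTheory.EllipticCurves.RootNumberSmulProofs
import Literature.NumberTheory.EllipticCurves.NonEisensteinPrimeOfSurjective
import Literature.NumberTheory.EllipticCurves.LFunctionSmulProofs
import Literature.NumberTheory.EllipticCurves.IsogenyVariableChangeProofs
import Literature.NumberTheory.EllipticCurves.MazurTorsion
import HarnessLib

/-!
# Katz 1981, Theorem 2 for elliptic curves over `ℚ` at prime-power level, and the non-Eisenstein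
# good prime modulo `ℓⁿ` from Mazur's torsion theorem

Topic `Literature/NumberTheory/EllipticCurves`; theorems only (no definition, no named fact, no
instance). Assembly of `Literature.NumberTheory.GaloisRepresentations.KatzDetCongruenceLattice`
(Katz 1981, Thm. 1: the lattice theorem, proved) with
`Literature.NumberTheory.EllipticCurves.KatzLatticeRationalTorsionProofs` (the two elliptic-curve
ends), giving:

* `exists_isogeny_addOrderOf_eq_prime_pow_of_frobeniusTrace_congr` — **Katz 1981, Thm. 2 for
  `E/ℚ`, prime-power level, order form**: if `W/ℚ` is globally minimal and
  `ℓⁿ ∣ a_r(W) − r − 1` (i.e. `ℓⁿ ∣ #W̃(𝔽_r)`) for every good prime `r ≠ ℓ` outside a finite set,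
  then there are `a + b = n` and elliptic curves `E', E''`, `ℚ`-isogenous to `E`, with rational
  points of order exactly `ℓᵃ` resp. `ℓᵇ` (Katz: `E'` with `ℓⁿ ∣ #E'(ℚ)_tors`; indeed
  `E' = E''` and `E'(ℚ) ⊇ ℤ/ℓᵃ × ℤ/ℓᵇ`, Cullinan–Kenney–Voight 2022, Thm. 2.3.1 and (2.3.3) —
  the order form recorded here is what Mazur's bound consumes);
  `exists_isIsogenous_addOrderOf_eq_prime_pow_of_forall_dvd_lFunction_sub` — the same for an
  arbitrary model (`a_r = W.LFunction r`, good primes `r ∤ N_E`), through a global minimal model.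
* `exists_prime_not_pow_dvd_lFunction_sub_of_addOrderOf_le`,
  `exists_prime_not_pow_dvd_lFunction_sub_of_mazur_torsion` — **the non-Eisenstein good prime
  modulo a prime power**: if every rational torsion point of every elliptic curve over `ℚ` has
  order `≤ B` (Mazur 1977, Thm. (8): `B = 12`, tree named fact `mazur_torsion` in the order form
  `Mazur1977_addOrderOf_le_of_mazur_torsion`) and `ℓⁿ > B²`, then every `E/ℚ` has, outside any
  finite set `S`, a good prime `r ≠ ℓ` with `a_r(E) ≢ r + 1 (mod ℓⁿ)`. This is Pasten 2024,
  Lemma 6.7 (`ℓ^{β_S(ℓ)} ∤ r + 1 − a_r` for some good `r`) with the explicit exponent `β(ℓ) = n`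
  for ANY `ℓⁿ > 144` — e.g. `β = 8` for `ℓ ∈ {2, 3, 5, 7}` — and for all `E/ℚ` (no semi-stability),
  from Mazur's TORSION theorem and Katz's theorem instead of Faltings' theorem (printed proof,
  Lemmas 6.4–6.6) or Mazur's isogeny theorem (Lemma 6.3, `ℓ > 163`).

## References

* [Katz1980] N. M. Katz, *Galois properties of torsion points on abelian varieties*, Invent.
  Math. 62 (1981) 481–502, Thms. 1, 2.
* [CullinanKenneyVoight2022] J. Cullinan, M. Kenney, J. Voight, J. Théor. Nombres Bordeaux 34
  (2022), Thm. 2.3.1, (2.3.3).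
* [Mazur1977] B. Mazur, *Modular curves and the Eisenstein ideal*, Publ. Math. IHÉS 47 (1977),
  Thm. (8).
* [PastenShimura2024] H. Pasten, *Shimura curves and the abc conjecture*, J. Number Theory 254
  (2024) = arXiv:1705.09251, Lemma 6.7 (p. 22) and Lemma 6.14 (p. 23).
-/

noncomputable section

open scoped Classical Matrix

open NumberField IsDedekindDomain Field WeierstrassCurve
open Literature.NumberTheory.GaloisRepresentations (katz_exists_monoidHom_of_det_one_sub_dvd)

namespace Literature.NumberTheory.EllipticCurves

/-- **Katz 1981, Thm. 2 for `E/ℚ` at level `ℓⁿ` (order form).** Let `W/ℚ` be a globally minimal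
elliptic curve, `ℓ` a prime, `n ≥ 0` and `S` a finite set of primes such that
`ℓⁿ ∣ a_r(W) − (r + 1)` for every prime `r ≠ ℓ`, `r ∉ S`, of good reduction. Then there are
`a + b = n` and, for each of `ℓᵃ`, `ℓᵇ`, an elliptic curve `ℚ`-isogenous to `W` with a rational
point of exactly that order. Proof: the matrices of `Γ_ℚ` on a `ℤ_ℓ`-basis of `T_ℓ E` satisfy
`ℓⁿ ∣ det(1 − ρ(σ))` (`pow_dvd_det_one_sub_toMatrix_galoisRepTate`); Katz's lattice theorem
(`katz_exists_monoidHom_of_det_one_sub_dvd`) conjugates them into `G(n; a, b)`; and a lattice of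
shape `(a, b)` yields the two rational points (`exists_isogeny_addOrderOf_eq_pow_of_lattice`).
[cite: Katz1980, Thm. 2] [cite: CullinanKenneyVoight2022, Thm. 2.3.1] -/
theorem exists_isogeny_addOrderOf_eq_prime_pow_of_frobeniusTrace_congr (W : WeierstrassCurve ℚ)
    [W.IsElliptic] [W.IsGloballyMinimal] (ℓ : ℕ) [Fact ℓ.Prime] (n : ℕ) (S : Set ℕ)
    (hS : S.Finite)
    (hcongr : ∀ (r : ℕ) [Fact r.Prime], r ≠ ℓ → r ∉ S → W.HasGoodReductionAtPrime r →
      ((ℓ ^ n : ℕ) : ℤ) ∣ W.frobeniusTrace r - (r + 1)) :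
    ∃ a b : ℕ, a + b = n ∧
      (∃ (W' : WeierstrassCurve ℚ) (_ : W'.IsElliptic) (_ : Isogeny W W') (Q : W'.toAffine.Point),
        addOrderOf Q = ℓ ^ a) ∧
      (∃ (W' : WeierstrassCurve ℚ) (_ : W'.IsElliptic) (_ : Isogeny W W') (Q : W'.toAffine.Point),
        addOrderOf Q = ℓ ^ b) := by
  classical
  have hℓ : ℓ.Prime := Fact.out
  haveI : Module.Free ℤ_[ℓ] (W.tateModule ℓ) := module_free_tateModule_holds W ℓ
  haveI : Module.Finite ℤ_[ℓ] (W.tateModule ℓ) := module_finite_tateModule_holds W ℓ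
  have h2 : Module.finrank ℤ_[ℓ] (W.tateModule ℓ) = 2 :=
    finrank_tateModule_eq_two_holds W ℓ (Nat.cast_ne_zero.mpr hℓ.ne_zero)
  let bT : Module.Basis (Fin 2) ℤ_[ℓ] (W.tateModule ℓ) := Module.finBasisOfFinrankEq _ _ h2
  -- the matrices of the Galois action
  let M : absoluteGaloisGroup ℚ →* Matrix (Fin 2) (Fin 2) ℤ_[ℓ] :=
    { toFun := fun τ ↦ LinearMap.toMatrix bT bT (W.galoisRepTate ℓ τ)
      map_one' := by rw [map_one, LinearMap.toMatrix_one]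
      map_mul' := fun a b ↦ by rw [map_mul, LinearMap.toMatrix_mul] }
  have hM : ∀ τ, M τ = LinearMap.toMatrix bT bT (W.galoisRepTate ℓ τ) := fun τ ↦ rfl
  have hdet : ∀ σ, (ℓ : ℤ_[ℓ]) ^ n ∣ (1 - M σ).det := fun σ ↦
    pow_dvd_det_one_sub_toMatrix_galoisRepTate W ℓ bT S hS hcongr σ
  -- Katz's lattice theorem
  obtain ⟨P, a, b, ρ', hP, hab, hconj, -, hshape⟩ :=
    katz_exists_monoidHom_of_det_one_sub_dvd M n hdet
  have hshape' : ∀ σ (i j : Fin 2), (ℓ : ℤ_[ℓ]) ^ (![a, b] i) ∣ (ρ' σ - 1) i j := by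
    intro σ i j
    obtain ⟨h00, h01, h10, h11⟩ := hshape σ
    fin_cases i <;> fin_cases j
    · simpa [Matrix.sub_apply] using h00
    · simpa [Matrix.sub_apply] using h01
    · simpa [Matrix.sub_apply] using h10
    · simpa [Matrix.sub_apply] using h11
  have hconj' : ∀ σ, LinearMap.toMatrix bT bT (W.galoisRepTate ℓ σ) * P = P * ρ' σ := fun σ ↦
    hconj σ
  refine ⟨a, b, hab, ?_, ?_⟩
  · simpa using exists_isogeny_addOrderOf_eq_pow_of_lattice W ℓ bT hP ![a, b] ρ' hconj' hshape' 0
  · simpa using exists_isogeny_addOrderOf_eq_pow_of_lattice W ℓ bT hP ![a, b] ρ' hconj' hshape' 1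

/-- **Katz's theorem at level `ℓⁿ` for an arbitrary model**, `a_r(E) = W.LFunction r` and good
primes read as `r ∤ N_E` (through a global minimal model `C • W`: `hasGlobalMinimalModel_rat_holds`,
`LFunction_smul`, `conductorNorm_smul`, `LFunction_apply_prime_eq_frobeniusTrace`,
`not_dvd_conductorNorm_of_hasGoodReductionAtPrime`, `isIsogenous_smul`): some elliptic curves
`ℚ`-isogenous to `W` carry rational points of orders `ℓᵃ`, `ℓᵇ` with `a + b = n`.
[cite: Katz1980, Thm. 2] [cite: CullinanKenneyVoight2022, Thm. 2.3.1] -/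
theorem exists_isIsogenous_addOrderOf_eq_prime_pow_of_forall_dvd_lFunction_sub
    (W : WeierstrassCurve ℚ) [W.IsElliptic] (ℓ : ℕ) [Fact ℓ.Prime] (n : ℕ) (S : Set ℕ)
    (hS : S.Finite)
    (h : ∀ r : ℕ, r.Prime → r ≠ ℓ → r ∉ S → ¬ r ∣ W.conductorNorm ℤ →
        ((ℓ ^ n : ℕ) : ℤ) ∣ W.LFunction r - (r + 1)) :
    ∃ a b : ℕ, a + b = n ∧
      (∃ (W' : WeierstrassCurve ℚ) (_ : W'.IsElliptic), IsIsogenous W W' ∧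
        ∃ Q : W'.toAffine.Point, addOrderOf Q = ℓ ^ a) ∧
      (∃ (W' : WeierstrassCurve ℚ) (_ : W'.IsElliptic), IsIsogenous W W' ∧
        ∃ Q : W'.toAffine.Point, addOrderOf Q = ℓ ^ b) := by
  obtain ⟨C, hC⟩ := hasGlobalMinimalModel_rat_holds W
  haveI := hC
  have hcongr : ∀ (r : ℕ) [Fact r.Prime], r ≠ ℓ → r ∉ S → (C • W).HasGoodReductionAtPrime r →
      ((ℓ ^ n : ℕ) : ℤ) ∣ (C • W).frobeniusTrace r - (r + 1) := by
    intro r _ hrℓ hrS hgood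
    have hN : ¬ r ∣ W.conductorNorm ℤ := by
      rw [← conductorNorm_smul ℤ W C]
      exact not_dvd_conductorNorm_of_hasGoodReductionAtPrime (C • W) hgood
    rw [← LFunction_apply_prime_eq_frobeniusTrace (C • W) r hgood, LFunction_smul W C]
    exact h r Fact.out hrℓ hrS hN
  obtain ⟨a, b, hab, ⟨W', hW', g, Q, hQ⟩, ⟨W'', hW'', g', Q', hQ'⟩⟩ :=
    exists_isogeny_addOrderOf_eq_prime_pow_of_frobeniusTrace_congr (C • W) ℓ n S hS hcongr
  haveI := hW'
  haveI := hW''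
  exact ⟨a, b, hab, ⟨W', hW', (isIsogenous_smul W C).trans' ⟨g⟩, Q, hQ⟩,
    ⟨W'', hW'', (isIsogenous_smul W C).trans' ⟨g'⟩, Q', hQ'⟩⟩

/-- **The non-Eisenstein good prime modulo a prime power, from a uniform bound on rational
torsion orders.** If every rational torsion point of every elliptic curve over `ℚ` has order
`≤ B`, and `ℓⁿ > B²`, then for every `E/ℚ` (any model `W`) and every finite set `S` there is a
prime `r ≠ ℓ`, `r ∉ S`, `r ∤ N_E` with `ℓⁿ ∤ a_r(E) − (r + 1)` (contrapositive of
`exists_isIsogenous_addOrderOf_eq_prime_pow_of_forall_dvd_lFunction_sub`: `ℓᵃ, ℓᵇ ≤ B` would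
give `ℓⁿ = ℓᵃ ℓᵇ ≤ B²`). [cite: Katz1980, Thm. 2] [cite: PastenShimura2024, Lemma 6.7 p. 22] -/
theorem exists_prime_not_pow_dvd_lFunction_sub_of_addOrderOf_le {B : ℕ}
    (hB : ∀ (V : WeierstrassCurve ℚ) [V.IsElliptic] (Q : V.toAffine.Point),
      IsOfFinAddOrder Q → addOrderOf Q ≤ B)
    (W : WeierstrassCurve ℚ) [W.IsElliptic] (ℓ : ℕ) [Fact ℓ.Prime] {n : ℕ} (hn : B * B < ℓ ^ n)
    (S : Set ℕ) (hS : S.Finite) :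
    ∃ r : ℕ, r.Prime ∧ r ≠ ℓ ∧ r ∉ S ∧ ¬ r ∣ W.conductorNorm ℤ ∧
      ¬ ((ℓ ^ n : ℕ) : ℤ) ∣ W.LFunction r - (r + 1) := by
  have hℓ : ℓ.Prime := Fact.out
  by_contra hne
  push Not at hne
  obtain ⟨a, b, hab, ⟨W', hW', -, Q, hQ⟩, ⟨W'', hW'', -, Q', hQ'⟩⟩ :=
    exists_isIsogenous_addOrderOf_eq_prime_pow_of_forall_dvd_lFunction_sub W ℓ n S hS
      fun r hr hrℓ hrS hN ↦ hne r hr hrℓ hrS hN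
  haveI := hW'
  haveI := hW''
  have ha : ℓ ^ a ≤ B := by
    rw [← hQ]
    exact hB W' Q (addOrderOf_pos_iff.mp (by rw [hQ]; exact pow_pos hℓ.pos a))
  have hb : ℓ ^ b ≤ B := by
    rw [← hQ']
    exact hB W'' Q' (addOrderOf_pos_iff.mp (by rw [hQ']; exact pow_pos hℓ.pos b))
  have : ℓ ^ n ≤ B * B := by
    rw [← hab, pow_add]
    exact Nat.mul_le_mul ha hb
  omega

/-- **Mazur's torsion theorem bounds rational torsion orders by `12`** (Mazur 1977, Thm. (8), in
the order form `Mazur1977_addOrderOf_le_of_mazur_torsion`: `≤ 10` or `= 12`).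
[cite: Mazur1977, Thm. (8) and Cor. III.(5.2) p. 156] -/
theorem addOrderOf_le_twelve_of_mazur_torsion (V : WeierstrassCurve ℚ) [V.IsElliptic]
    (hMT : mazur_torsion V) (Q : V.toAffine.Point) (hQ : IsOfFinAddOrder Q) :
    addOrderOf Q ≤ 12 := by
  rcases Mazur1977_addOrderOf_le_of_mazur_torsion V hMT Q hQ with h | h <;> omega

/-- **Pasten 2024, Lemma 6.7 with an explicit exponent at every prime, from Mazur's TORSION
theorem** (printed: from Faltings' theorem, Lemmas 6.4–6.6, non-effective `β_S(ℓ)`; and for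
`ℓ > 163` from Mazur's isogeny theorem, Lemma 6.3): granted `mazur_torsion` for all elliptic
curves over `ℚ`, for every prime `ℓ`, every `n` with `ℓⁿ > 144`, every `E/ℚ` (any model, no
semi-stability hypothesis) and every finite `S` there is a prime `r ≠ ℓ`, `r ∉ S`, `r ∤ N_E`, with
`a_r(E) ≢ r + 1 (mod ℓⁿ)`. With `exists_prime_not_dvd_lFunction_sub_of_mazur_torsion`
(`n = 1`, `ℓ ≥ 11`) this supplies ALL the Eisenstein exponents of Pasten's Lemma 6.14.
[cite: PastenShimura2024, Lemma 6.7 p. 22 and Lemma 6.14 p. 23] [cite: Mazur1977, Thm. (8)] [cite: Katz1980, Thm. 2] -/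
theorem exists_prime_not_pow_dvd_lFunction_sub_of_mazur_torsion
    (hMT : ∀ V : WeierstrassCurve ℚ, mazur_torsion V) (W : WeierstrassCurve ℚ) [W.IsElliptic]
    (ℓ : ℕ) [Fact ℓ.Prime] {n : ℕ} (hn : 144 < ℓ ^ n) (S : Set ℕ) (hS : S.Finite) :
    ∃ r : ℕ, r.Prime ∧ r ≠ ℓ ∧ r ∉ S ∧ ¬ r ∣ W.conductorNorm ℤ ∧
      ¬ ((ℓ ^ n : ℕ) : ℤ) ∣ W.LFunction r - (r + 1) :=
  exists_prime_not_pow_dvd_lFunction_sub_of_addOrderOf_le (B := 12)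
    (fun V _ Q hQ ↦ addOrderOf_le_twelve_of_mazur_torsion V (hMT V) Q hQ) W ℓ hn S hS

end Literature.NumberTheory.EllipticCurves

end
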